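import Summits.BirchSwinnertonDyer.Rank1Residual.X11a.PrintDischarge
import Summits.BirchSwinnertonDyer.BirchSwinnertonDyer.Theorems.ErratumRoadFiveNonSurjCornerTwinMuOfLane
import Summits.BirchSwinnertonDyer.BirchSwinnertonDyer.Theorems.ErratumRoadFiveNonSurjCornerTwinKatoEngine
import Summits.BirchSwinnertonDyer.Rank1Residual.X2.ClassClosureEntireFree
import Summits.BirchSwinnertonDyer.Rank1Residual.X11a.ChainBySplitType
import Literature.NumberTheory.EllipticCurves.Kato2004.IwasawaCohomologyExistsProofs
import Literature.NumberTheory.EllipticCurves.IwasawaLeadingTermProofs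
import HarnessLib

/-!
# Class X11a — the PRINT route's discharge interface, part 6: the ANALYTIC-μ road PER PAIR on the
# non-surjective sub-leaf BY NAME (crux `X11aNonSurjEulerHalf`, items 20406 / 20613 / 20614) and the
# EXCEPTIONAL-ZERO door at a split pair (the μ-claim from the 𝓛-invariant)

Cell `bsd-print-x11a` (D-0131 print tier), seat ty2 (the DISCHARGE INTERFACE: leaf predicate ⟹ the
cited theorems' hypotheses, sorry-free, so that provers close BY NAME). THEOREMS ONLY (no definition,
no named fact, no `sorry`). Parts 1–5: `PrintDischarge.lean` (atoms, walls, bundles, glue),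
`PrintDischargeFouquet.lean`, `PrintDischargeTransport.lean` (the μ-TRANSPORT road on the SURJECTIVE
leaf), `PrintDischargeEulerHalf.lean` (the Euler half per pair: Wuthrich, descents, Cha), and
`PrintDischargeHeegner.lean` (Heegner-index doors with the field clauses discharged).

## What this part adds

The route's crux 3 (`X11aNonSurjEulerHalf`, split by the prime into `UpperNonSurjThree` ∣
`UpperNonSurjFive`) is, modulo named facts, Greenberg's `μ = 0` on the non-surjective X11a pairs
(p3's files `Theorems/PrintX11aNonSurjEulerHalfOf{Mu,Branches}.lean`). PER PAIR that `μ`-statement has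
an ANALYTIC certificate: `X11a.MuAnZeroAt W p` — «for every newform `f` of `E` and every `ϖ` with
`ϖ·Ω_E = Ω⁺_f`, SOME coefficient of the Néron-normalised Mazur–Tate–Teitelbaum series `ϖ·L_p` is a
`p`-adic unit» (`X11a/MuLambdaSplit.lean`) — which is VERBATIM the claim `Record.MuClaim` carried by a
certificate record of `Literature/…/X11aPrintCertificates/ClaimMu.lean` whose μ-witness column is
non-empty (ty3's two-engine μ-witness: a unit Teichmüller-coset sum of modular symbols, kernel-rechecked
arithmetic). The K2 cell landed the kernel chain at a multiplicative odd `p` with `E[p]` irreducible and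
`ρ̄` NOT onto: `X11a.MuAnZeroAt ⟹ X11b.MultDivisibilityAt` (`X11b.multDivisibilityAt_of_katoFacts_of_muAnZeroAt`,
corner-p1 g6's μ-transfer WITHOUT big image, file `ErratumRoadFiveNonSurjCornerTwinMuOfLane.lean`) and
`MultDivisibilityAt ⟹ Typed.MissingUpperBoundAt` on `ClassX11a`
(`X11b.missingUpperBoundAt_of_classX11a_of_multDivisibilityAt`, exceptional zero ∕ 𝓛-invariant inside,
file `ErratumRoadFiveNonSurjCornerTwinKatoEngine.lean`). This file states the composite AS ONE DOOR on
the class, with the pair side discharged and with the two conjuncts of p3's thirteen-fact list that are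
NOT print inputs DISCHARGED IN THE TREE (cell lit g3, DOSSIER §19 T19-a/b; REF g2 INFO):
`Kato2004.nonempty_iwasawaH1Data` is PROVED (`Kato2004.nonempty_iwasawaH1Data_holds`) and
`hasEntireLFunction_rat` follows from `nonempty_modularParametrizationData`
(`hasEntireLFunction_rat_of_exists_isNewformOf ∘ exists_isNewformOf_of_nonempty_modularParametrizationData`, packaged
as `X2.ClassClosureEntireFree.hasEntireLFunction_rat_of_nonempty_modularParametrizationData`).
What remains displayed per pair is: TEN named Literature facts (Stein–Wuthrich 2013 Thm. 6.1 ×2, GZK,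
modular parametrisation, Kato 2004 Thm. 12.4, Kato §17.13 construction facts ×3 (non-split, split,
fine), Greenberg 1999 Thm. 1.5, Wuthrich 2014 Cor. 18) + Greenberg–Stevens at the pair + the class
`ClassX11a W p` + the image bit `¬ Surj W p` + the μ-claim.

* §1 `ClassX11a.multDivisibilityAt_of_muAnZeroAt_of_not_surj`,
  **`ClassX11a.missingUpperBoundAt_of_muAnZeroAt_of_not_surj`** (crux-U currency at the pair, BOTH
  regimes `p = 3` ∣ `p ≥ 5`, split AND non-split `p`, unit AND non-unit special value),
  `ClassX11a.bsdp_of_muAnZeroAt_of_not_surj` (+ the lower half), `…_of_unit` and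
  `ClassX11a.halves_of_muAnZeroAt_of_not_surj_of_unit` (at a pair with `ord_p #Ш_an = 0` the lower
  half is free, so the μ-claim closes `BSD(E,p)` and delivers BOTH crux currencies).
* §1c the NON-SPLIT variants `…_of_nonsplit[_of_unit]` (Greenberg–Stevens vacuous at a non-split prime; REF T4-a).
* §1b the EXCEPTIONAL-ZERO door at a SPLIT pair: `ClassX11a.muAnZeroAt_of_split_of_norm_LInvariant`
  — by Greenberg–Stevens `L_p'(E,0) = 𝓛_p(E)·L(E,1)/Ω_E` the coefficient of `T` in `ϖ·L_p` is
  `𝓛_p(E)·t/log_p γ` (`t = L(E,1)/Ω_E`), a unit iff `‖𝓛_p(E)·t‖_p = p⁻¹`: the μ-claim from TWO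
  displayed numbers and no modular symbol — `hnsj`-free, LIVE ONLY ON THE SURJECTIVE split locus
  (K2's `X11a.Chain…` μ-consumers); on the non-surjective sub-leaf it is VACUOUS (local splitting of the
  Tate extension, census below), so NO composition with §1's `¬Surj` door is offered (REF g4 ruling
  R4-1, lit g5 F26-2): split non-surjective pairs go through part 7's record door with a μ-witness of
  coefficient index `≥ 2`.
  The two ¬Surj compositions of the first landing (p549884) stay as `@[deprecated]` VACUOUS tombstones (append-only).
* Part 7 (`PrintDischargeMuAnRecords.lean`): the record-level consumers of the certificate schema's
  μ-claim (`Record.MuClaim`, `ClaimMu.lean`) and the Kraus–Oesterlé 1992 Prop. 4 door.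

Scope (numbers, cell census N < 5·10⁵ at `p = 5`, ty3's `RecordsLeafNonSurjN500000Part1/2`): 56
non-surjective X11a pairs, every one with `5 ∤ #Ш_an` (values 1, 4, 9), so the LOWER half is free on
all of them and crux U is the whole residue; 13 (5Ns) are closed by Shapiro descents, 16 non-split 5S4
by Heegner-index certificates (parts 4–5 doors); the μ-claim door of this file is uniform over the rest —
in particular over the 12 SPLIT 5S4 pairs (`6480d1`, `25920q1`, `51840l1/m1`, `56180e1`, `64980g1/bg1`,
`74060i1`, `92480eh1`, `184960ck1/l1`, `224720j1`, `259920ec1/hc1`, `346560fq1/lh1`, `389205n1`) and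
the non-split pairs whose `L(E,1)/Ω_E` is NOT a `p`-adic unit (`74060f1`, `86640dt1`, `115320u1`,
`152280q1`, `230640bz1`, `346680j1`, …), where neither the unit-value door (p3 §6) nor the Heegner-index
doors apply. HONEST FRAMING: nothing here proves `μ = 0` or a μ-claim at any pair; three of the ten
facts are CONSTRUCTION facts of cells bsd-2adic ∕ bsd-stepL (`Kato2004.exists_multDivisibilityInputs_*`,
register flags INFO per REF g2); per pair this is E1 currency, never the leaf; the leaf `ClassX11a`
stays open; BSD is not proved by any of this. beyond-print theorem: no.

References: [Kato2004Asterisque] Thm. 12.4 (p. 221), Thm. 12.6 (p. 222), §17.13 (pp. 279–280);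
[Wuthrich2014] Cor. 18 (p. 398), Prop. 21 (p. 400); [SteinWuthrich2013] Thm. 6.1 (p. 20);
[GreenbergLNM1716] Thm. 1.5, Conj. 1.11; [GreenbergStevens1993] Thm. (0.3); [Kobayashi2006DocMath]
Cor. 4.2; [MazurTateTeitelbaum1986] §I.10, §I.13; [Miller2011LMS] Def. 1.1; [KrausOesterle1992]
Prop. 4 (pp. 263–264); cell files `pub/bsd-print-x11a/TY2-DISCHARGE-INTERFACE.md` §J, `PLAN.md`,
`P3-EXCEPTIONAL-ZERO-ROAD.md`, `TY3-CERTIFICATE-RECORDS.md`. -/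

set_option autoImplicit false

noncomputable section

open scoped Classical MatrixGroups ModularForm

open CongruenceSubgroup WeierstrassCurve Literature.NumberTheory.EllipticCurves
  Literature.NumberTheory.EllipticCurves.ModularForms
  Literature.NumberTheory.EllipticCurves.Rank1Residual
  Literature.NumberTheory.EllipticCurves.Rank1Residual.Typed
  Literature.NumberTheory.EllipticCurves.Wuthrich2014
  Literature.NumberTheory.EllipticCurves.SteinWuthrich2013
  Literature.NumberTheory.EllipticCurves.Greenberg1999
  Literature.NumberTheory.EllipticCurves.Kato2004

namespace Summit.BirchSwinnertonDyer.Rank1Residual.X11a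

/-! ### §0 The two conjuncts of the thirteen-fact list that the tree PROVES (lit g3 §19 T19-a/b)

Used below and NOT displayed: `Kato2004.nonempty_iwasawaH1Data_holds` (Kato (12.2.1): the Iwasawa
cohomology `𝐇¹` exists as a `Λ`-module — `Kato2004/IwasawaCohomologyExistsProofs.lean`) and
`X2.ClassClosureEntireFree.hasEntireLFunction_rat_of_nonempty_modularParametrizationData` (the entire
continuation of `L(E,s)` from the modular parametrisation `X₀(N) → E`, via a newform of `E` —
`X2/ClassClosureEntireFree.lean`). -/

variable {W : WeierstrassCurve ℚ} [W.IsElliptic] [W.IsGloballyMinimal] {p : ℕ} [Fact p.Prime]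

/-! ### §1 The analytic-μ door on the non-surjective sub-leaf (any odd `p`: both regimes of crux U) -/

/-- **`X11a.MuAnZeroAt ⟹ X11b.MultDivisibilityAt` on the non-surjective X11a sub-leaf**, modulo Kato
2004 Thm. 12.4, the three §17.13 construction facts (non-split, split, fine quotient at `p ∥ N`),
Greenberg 1999 Thm. 1.5 and Wuthrich 2014 Cor. 18 — the K2 cell's kernel μ-transfer WITHOUT big image
(`X11b.multDivisibilityAt_of_katoFacts_of_muAnZeroAt`, which USES `Irr ∧ ¬Surj`), with `p ≠ 2`, `Mult`,
`Irr` from the class and Kato's (12.2.1) existence fact discharged by its `_holds`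
(`Kato2004.nonempty_iwasawaH1Data_holds`). PER PAIR; the μ-claim `hμ` is the displayed certificate.
[cite: Kato2004Asterisque, Thm. 12.4 (p. 221), Thm. 12.6 (p. 222), §17.13 (pp. 279–280)]
[cite: Wuthrich2014, Cor. 18 (p. 398)] [cite: GreenbergLNM1716, Thm. 1.5] -/
theorem _root_.Summit.BirchSwinnertonDyer.Rank1Residual.ClassX11a.multDivisibilityAt_of_muAnZeroAt_of_not_surj
    (h12 : Kato2004.thm12_4)
    (hns : Kato2004.exists_multDivisibilityInputs_nonsplit)
    (hsp : Kato2004.exists_multDivisibilityInputs_split)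
    (h15 : thm15_isTorsion_multiplicative_rat)
    (h18 : Wuthrich2014.corollary18_padicLFunction_mem_iwasawaAlgebra_multiplicative)
    (hfine : Kato2004.exists_multDivisibilityInputs_fine)
    (hX : ClassX11a W p) (hnsj : ¬ Surj W p) (hμ : X11a.MuAnZeroAt W p) :
    X11b.MultDivisibilityAt W p :=
  X11b.multDivisibilityAt_of_katoFacts_of_muAnZeroAt Kato2004.nonempty_iwasawaH1Data_holds h12 hns hsp
    h15 h18 hfine W p hX.ne_two hX.mult hX.irr hnsj hμ

/-- **THE μ-CLAIM DOOR: `X11a.MuAnZeroAt W p ⟹ Typed.MissingUpperBoundAt W p` at a non-surjective X11a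
pair** — the currency of crux `X11aNonSurjEulerHalf` (items 20406 ∕ 20613 ∕ 20614) AT THE PAIR, for any
odd `p` (so both the `p = 3` and the `p ≥ 5` regime), split or non-split, unit or non-unit special
value. Displayed: TEN named facts — Stein–Wuthrich 2013 Thm. 6.1 split ∕ non-split (`hJs`, `hJn`), GZK
(`hGZK`), modular parametrisation (`hpar`), Kato 2004 Thm. 12.4 (`h12`), Kato §17.13 construction facts
(`hns`, `hsp`, `hfine`), Greenberg 1999 Thm. 1.5 (`h15`), Wuthrich 2014 Cor. 18 (`h18`) —, Greenberg–Stevens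
at the pair (`hGS`), the class, the image bit `¬ Surj W p`, and the μ-claim `hμ`; the entire
continuation and Kato's (12.2.1) existence are NOT displayed (tree theorems, §0). Chain: §1 ∘
`X11b.missingUpperBoundAt_of_classX11a_of_multDivisibilityAt` (exceptional zero ∕ 𝓛-invariant inside).
CONDITIONAL on the displayed facts; closes nothing class-wide.
[cite: Kato2004Asterisque, Thm. 12.4 (p. 221), §17.13 (pp. 279–280)] [cite: Wuthrich2014, Cor. 18 (p. 398)]
[cite: SteinWuthrich2013, Thm. 6.1 (p. 20)] [cite: GreenbergStevens1993, Thm. (0.3) (p. 407)]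
[cite: MazurTateTeitelbaum1986, §I.10 and §I.13] [cite: Miller2011LMS, Def. 1.1 (arXiv:1010.2431 p. 3)] -/
theorem _root_.Summit.BirchSwinnertonDyer.Rank1Residual.ClassX11a.missingUpperBoundAt_of_muAnZeroAt_of_not_surj
    (hJs : thm61_splitMultiplicative) (hJn : thm61_nonsplitMultiplicative)
    (hGZK : rank_eq_analyticRank_of_analyticRank_le_one) (hpar : nonempty_modularParametrizationData)
    (h12 : Kato2004.thm12_4)
    (hns : Kato2004.exists_multDivisibilityInputs_nonsplit)
    (hsp : Kato2004.exists_multDivisibilityInputs_split)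
    (h15 : thm15_isTorsion_multiplicative_rat)
    (h18 : Wuthrich2014.corollary18_padicLFunction_mem_iwasawaAlgebra_multiplicative)
    (hfine : Kato2004.exists_multDivisibilityInputs_fine)
    (hGS : greenberg_stevens (W := W) (p := p))
    (hX : ClassX11a W p) (hnsj : ¬ Surj W p) (hμ : X11a.MuAnZeroAt W p) :
    MissingUpperBoundAt W p :=
  X11b.missingUpperBoundAt_of_classX11a_of_multDivisibilityAt hJs hJn hGZK
    (X2.ClassClosureEntireFree.hasEntireLFunction_rat_of_nonempty_modularParametrizationData hpar) hpar W p hGS hX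
    (hX.multDivisibilityAt_of_muAnZeroAt_of_not_surj h12 hns hsp h15 h18 hfine hnsj hμ)

/-- **The μ-claim and the LOWER half close `BSD(E,p)` at a non-surjective X11a pair** (both halves ⇒
`BSDp`, part 1 `ClassX11a.bsdp_of_halves`; GZK only on the output side). The lower half
`MissingLowerBoundAt W p` is crux `X11aLowerHalf` (item 19064) at the pair — free when `ord_p #Ш_an = 0`
(`0 ≤` a natural number; cf. `AdditiveBranchIMCGordTwoRankOne.missingLowerBoundAt_of_shaAn_padicValRat_eq_zero`). [cite: Miller2011LMS, §1 and Def. 1.1] [cite: Kato2004Asterisque, §17.13 (pp. 279–280)]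
[cite: Wuthrich2014, Cor. 18 (p. 398)] -/
theorem _root_.Summit.BirchSwinnertonDyer.Rank1Residual.ClassX11a.bsdp_of_muAnZeroAt_of_not_surj
    (hJs : thm61_splitMultiplicative) (hJn : thm61_nonsplitMultiplicative)
    (hGZK : rank_eq_analyticRank_of_analyticRank_le_one) (hpar : nonempty_modularParametrizationData)
    (h12 : Kato2004.thm12_4)
    (hns : Kato2004.exists_multDivisibilityInputs_nonsplit)
    (hsp : Kato2004.exists_multDivisibilityInputs_split)
    (h15 : thm15_isTorsion_multiplicative_rat)
    (h18 : Wuthrich2014.corollary18_padicLFunction_mem_iwasawaAlgebra_multiplicative)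
    (hfine : Kato2004.exists_multDivisibilityInputs_fine)
    (hGS : greenberg_stevens (W := W) (p := p))
    (hX : ClassX11a W p) (hnsj : ¬ Surj W p) (hμ : X11a.MuAnZeroAt W p)
    (hlow : MissingLowerBoundAt W p) : BSDp W p :=
  hX.bsdp_of_halves hGZK hlow
    (hX.missingUpperBoundAt_of_muAnZeroAt_of_not_surj hJs hJn hGZK hpar h12 hns hsp h15 h18 hfine hGS hnsj hμ)

/-- **BOTH crux currencies at a non-surjective UNIT pair from the μ-claim**: `MissingLowerBoundAt`
(free, `ord_p #Ш_an = 0`) and `MissingUpperBoundAt` (the μ-claim door) — the bodies of items 19064 and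
20406 at the pair. [cite: Miller2011LMS, Def. 1.1] [cite: Kato2004Asterisque, §17.13 (pp. 279–280)]
[cite: Wuthrich2014, Cor. 18 (p. 398)] -/
theorem _root_.Summit.BirchSwinnertonDyer.Rank1Residual.ClassX11a.halves_of_muAnZeroAt_of_not_surj_of_unit
    (hJs : thm61_splitMultiplicative) (hJn : thm61_nonsplitMultiplicative)
    (hGZK : rank_eq_analyticRank_of_analyticRank_le_one) (hpar : nonempty_modularParametrizationData)
    (h12 : Kato2004.thm12_4)
    (hns : Kato2004.exists_multDivisibilityInputs_nonsplit)
    (hsp : Kato2004.exists_multDivisibilityInputs_split)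
    (h15 : thm15_isTorsion_multiplicative_rat)
    (h18 : Wuthrich2014.corollary18_padicLFunction_mem_iwasawaAlgebra_multiplicative)
    (hfine : Kato2004.exists_multDivisibilityInputs_fine)
    (hGS : greenberg_stevens (W := W) (p := p))
    (hX : ClassX11a W p) (hnsj : ¬ Surj W p) (hμ : X11a.MuAnZeroAt W p)
    {q : ℚ} (hq : shaAn W = (q : ℂ)) (hv : padicValRat p q = 0) :
    MissingLowerBoundAt W p ∧ MissingUpperBoundAt W p :=
  ⟨⟨q, hq, by rw [hv]; exact Nat.cast_nonneg _⟩,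
    hX.missingUpperBoundAt_of_muAnZeroAt_of_not_surj hJs hJn hGZK hpar h12 hns hsp h15 h18 hfine hGS hnsj hμ⟩

/-- **`BSD(E,p)` at a non-surjective UNIT pair from the μ-claim** (`#Ш_an = q`, `ord_p q = 0`): the
two halves of the previous theorem through part 1's `ClassX11a.bsdp_of_halves`. PER PAIR, modulo the
ten facts + GS + the image bit + the μ-claim. [cite: Miller2011LMS, §1 and Def. 1.1]
[cite: Kato2004Asterisque, §17.13 (pp. 279–280)] [cite: Wuthrich2014, Cor. 18 (p. 398)] -/
theorem _root_.Summit.BirchSwinnertonDyer.Rank1Residual.ClassX11a.bsdp_of_muAnZeroAt_of_not_surj_of_unit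
    (hJs : thm61_splitMultiplicative) (hJn : thm61_nonsplitMultiplicative)
    (hGZK : rank_eq_analyticRank_of_analyticRank_le_one) (hpar : nonempty_modularParametrizationData)
    (h12 : Kato2004.thm12_4)
    (hns : Kato2004.exists_multDivisibilityInputs_nonsplit)
    (hsp : Kato2004.exists_multDivisibilityInputs_split)
    (h15 : thm15_isTorsion_multiplicative_rat)
    (h18 : Wuthrich2014.corollary18_padicLFunction_mem_iwasawaAlgebra_multiplicative)
    (hfine : Kato2004.exists_multDivisibilityInputs_fine)
    (hGS : greenberg_stevens (W := W) (p := p))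
    (hX : ClassX11a W p) (hnsj : ¬ Surj W p) (hμ : X11a.MuAnZeroAt W p)
    {q : ℚ} (hq : shaAn W = (q : ℂ)) (hv : padicValRat p q = 0) : BSDp W p :=
  hX.bsdp_of_muAnZeroAt_of_not_surj hJs hJn hGZK hpar h12 hns hsp h15 h18 hfine hGS hnsj hμ
    ⟨q, hq, by rw [hv]; exact Nat.cast_nonneg _⟩

/-! ### §1c The non-split variants: Greenberg–Stevens is vacuous at a non-split prime (display shrink) -/

/-- **The μ-claim door at a NON-SPLIT non-surjective X11a pair, WITHOUT the Greenberg–Stevens binder**: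
the tree's `greenberg_stevens (W := W) (p := p)` quantifies over `TateParameterData W p`, whose field
`split` is absurd at a non-split prime (`RankZeroHeightFree.greenberg_stevens_of_not_split`; REF g4
T4-a), so on the non-split locus (images 5Ns/5S4/7Ns/3Ns/3Nn with `a_p = −1`) §1's door displays only
the ten facts, the class, the image bit, the non-split bit and the μ-claim. [cite: Kato2004Asterisque, §17.13 (pp. 279–280)]
[cite: Wuthrich2014, Cor. 18 (p. 398)] [cite: SteinWuthrich2013, Thm. 6.1 (p. 20)] [cite: Miller2011LMS, Def. 1.1] -/
theorem _root_.Summit.BirchSwinnertonDyer.Rank1Residual.ClassX11a.missingUpperBoundAt_of_muAnZeroAt_of_not_surj_of_nonsplit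
    (hJs : thm61_splitMultiplicative) (hJn : thm61_nonsplitMultiplicative)
    (hGZK : rank_eq_analyticRank_of_analyticRank_le_one) (hpar : nonempty_modularParametrizationData)
    (h12 : Kato2004.thm12_4)
    (hns : Kato2004.exists_multDivisibilityInputs_nonsplit)
    (hsp : Kato2004.exists_multDivisibilityInputs_split)
    (h15 : thm15_isTorsion_multiplicative_rat)
    (h18 : Wuthrich2014.corollary18_padicLFunction_mem_iwasawaAlgebra_multiplicative)
    (hfine : Kato2004.exists_multDivisibilityInputs_fine)
    (hX : ClassX11a W p) (hnsj : ¬ Surj W p) (hnsp : ¬ W.HasSplitMultiplicativeReductionAtPrime p)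
    (hμ : X11a.MuAnZeroAt W p) : MissingUpperBoundAt W p :=
  hX.missingUpperBoundAt_of_muAnZeroAt_of_not_surj hJs hJn hGZK hpar h12 hns hsp h15 h18 hfine
    (RankZeroHeightFree.greenberg_stevens_of_not_split W p hnsp) hnsj hμ

/-- **`BSD(E,p)` at a NON-SPLIT non-surjective UNIT pair from the μ-claim, without the GS binder**
(§1 `…_of_unit` with `greenberg_stevens` discharged by non-splitness). PER PAIR (E1 currency).
[cite: Miller2011LMS, §1 and Def. 1.1] [cite: Kato2004Asterisque, §17.13 (pp. 279–280)]
[cite: Wuthrich2014, Cor. 18 (p. 398)] -/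
theorem _root_.Summit.BirchSwinnertonDyer.Rank1Residual.ClassX11a.bsdp_of_muAnZeroAt_of_not_surj_of_nonsplit_of_unit
    (hJs : thm61_splitMultiplicative) (hJn : thm61_nonsplitMultiplicative)
    (hGZK : rank_eq_analyticRank_of_analyticRank_le_one) (hpar : nonempty_modularParametrizationData)
    (h12 : Kato2004.thm12_4)
    (hns : Kato2004.exists_multDivisibilityInputs_nonsplit)
    (hsp : Kato2004.exists_multDivisibilityInputs_split)
    (h15 : thm15_isTorsion_multiplicative_rat)
    (h18 : Wuthrich2014.corollary18_padicLFunction_mem_iwasawaAlgebra_multiplicative)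
    (hfine : Kato2004.exists_multDivisibilityInputs_fine)
    (hX : ClassX11a W p) (hnsj : ¬ Surj W p) (hnsp : ¬ W.HasSplitMultiplicativeReductionAtPrime p)
    (hμ : X11a.MuAnZeroAt W p) {q : ℚ} (hq : shaAn W = (q : ℂ)) (hv : padicValRat p q = 0) : BSDp W p :=
  hX.bsdp_of_muAnZeroAt_of_not_surj_of_unit hJs hJn hGZK hpar h12 hns hsp h15 h18 hfine
    (RankZeroHeightFree.greenberg_stevens_of_not_split W p hnsp) hnsj hμ hq hv

/-! ### §1b The EXCEPTIONAL-ZERO door at a SPLIT pair: the μ-claim from two displayed numbers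

At a SPLIT multiplicative `p` the Mazur–Tate–Teitelbaum function has a trivial zero and
Greenberg–Stevens' formula `L_p'(E,0) = 𝓛_p(E)·L(E,1)/Ω_E` (tree fact `greenberg_stevens`, in the
tree's normalisation `coeff₁(L)·log_p γ = 𝓛_p(E)·[0]⁺_f`) computes the LINEAR coefficient of the
Néron-normalised series: `coeff₁(ϖ·L) = 𝓛_p(E)·t / log_p γ` with `t = L(E,1)/Ω_E = ϖ·[0]⁺_f` and
`‖log_p γ‖ = p⁻¹` (`γ = 1 + p`, `p` odd). So the μ-claim holds with witness `n = 1` as soon as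
`‖𝓛_p(E)·t‖_p = p⁻¹` — ONE displayed `p`-adic identity per pair (engines: the Tate parameter
`q_E = p^v u` to precision `p^{v+2}` from `j(E)`, `𝓛_p = log_p u / v`; and Miller's `t`), no modular
symbol. On the census's split non-surjective pairs `ord_5 t ≥ 1` and `5 ∣ v = v_5(Δ_min)` with
`25 ∤ v`, so the identity would read `ord_5 log_5 u = 1`, i.e. `u⁴ ≢ 1 (mod 25)`.

CENSUS (numbers, kit job j284371, PARI `ellinit(E, O(5^60)).tate`, this seat): at ALL 23 split
non-surjective X11a pairs `N < 5·10⁵` (the 12 split 5S4 pairs, the 5 split 5Ns pairs, and the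
companion/GRH-flagged ones) `u ≡ ±1, ±7 (mod 25)`, i.e. `u⁴ ≡ 1 (mod 25)`, `ord_5 log_5 u ≥ 2`,
`ord_5 𝓛_5(E) = ord_5 log_5 u − ord_5 v ≥ 1` and `ord_5(𝓛_5(E)·t) ≥ 2`: the door below is SILENT on
every one of them (0/23). This is structural, not an accident: a mod-`p` image of order prime to `p`
(5Ns/5S4/7Ns/3Ns/3Nn) restricted to `Γ_{ℚ_p}` has order prime to `p`, so the Tate extension
`0 → μ_p → E[p] → ℤ/p → 0` (class `q_E ∈ ℚ_pˣ/ℚ_pˣᵖ`) SPLITS: `q_E` is a `p`-th power in `ℚ_p`, i.e.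
`p ∣ v` (peu ramifié, part 4 `ClassX11a.dvd_padicValInt_self_of_not_surj`) AND `u ∈ (ℤ_pˣ)ᵖ`, whence
`log_p u ∈ p²ℤ_p` [cite: SerreInventiones1972, §1.12 (ρ̄ on the Tate curve) and §2.8]. So on the
non-surjective sub-leaf the first coefficient of `ϖ·L_p` is NEVER a unit and a μ-witness must come from
a coefficient of index `≥ 2` (§2's records, ty3's engine); the door is live only at split pairs whose
local representation is non-split (`u⁴ ≢ 1 (mod 25)`) with `ord_p t = 1 − ord_p 𝓛_p(E)` — on X11a these
are surjective pairs, where it feeds the surjective-leaf chains instead (`X11a/MainConjecture*.lean`).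
The lemma is kept (hnsj-free) because it is the p3 strategy sentence as a checkable per-pair statement
on the surjective split locus, and because its silence on the non-surjective sub-leaf is itself the
boundary finding just stated (REF g4 R4-1 / engine R kit j284417 §E–F; lit g5 DOSSIER §26.3 with Serre
1972 Prop. 15 p. 280 and §1.12 pp. 276–277 first-hand): no `¬Surj` composition is offered. -/

/-- **The μ-claim at a SPLIT multiplicative pair from the 𝓛-invariant** (exceptional-zero door):
on X11a with `p` split, if `L(E,1)/Ω_E = t` and `‖𝓛_p(E)·t‖_p = p⁻¹` for the (unique) Tate
parameter datum, then `X11a.MuAnZeroAt W p` — the coefficient of `T` in `ϖ·L_p` is a `p`-adic unit by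
Greenberg–Stevens (`hGS`: `coeff₁(L)·log_p γ = 𝓛_p(E)·[0]⁺_f`), `L(E,1) = [0]⁺_f·Ω⁺_f`
(`IsNewformOf.entireLFunction_one_eq`) and `log_p γ = p·unit` (`exists_unit_padicLog_cyclotomicGenerator`);
the Tate parameter exists at a multiplicative prime (`existsUnique_tateJ_eq_of_one_lt_norm`,
`one_lt_norm_j_of_hasMultiplicativeReductionAtPrime`). The non-split conjunct of the claim is vacuous.
PER PAIR; `t` and the norm identity are displayed engine data.
[cite: GreenbergStevens1993, Introduction Thm. (0.3) (p. 407) = Thm. 7.1 (p. 444)]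
[cite: MazurTateTeitelbaum1986, §I.13 and §II.1] [cite: Kobayashi2006DocMath, Cor. 4.2 (p. 575)] -/
theorem _root_.Summit.BirchSwinnertonDyer.Rank1Residual.ClassX11a.muAnZeroAt_of_split_of_norm_LInvariant
    (hGS : greenberg_stevens (W := W) (p := p)) (hX : ClassX11a W p)
    (hsplit : W.HasSplitMultiplicativeReductionAtPrime p)
    (t : ℚ) (ht : W.entireLFunction 1 / (W.realPeriodRat : ℂ) = (t : ℂ))
    (hexc : ∀ Dq : TateParameterData W p, ‖LInvariant Dq * ((t : ℚ) : ℚ_[p])‖ = (p : ℝ)⁻¹) :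
    X11a.MuAnZeroAt W p := by
  intro N _ f hf ϖ hϖ
  refine ⟨fun hns => absurd hsplit hns, fun _ L hL => ?_⟩
  -- the Tate parameter at the (split) multiplicative prime
  obtain ⟨q, ⟨hq0, hq1, hqj⟩, -⟩ := existsUnique_tateJ_eq_of_one_lt_norm
    (one_lt_norm_j_of_hasMultiplicativeReductionAtPrime (W := W) (p := p) hX.mult)
  let Dq : TateParameterData W p := ⟨q, hq0, hq1, hqj, hsplit⟩
  obtain ⟨-, h1⟩ := hGS Dq hf hL
  -- `ϖ · [0]⁺_f = L(E,1)/Ω_E = t`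
  have hΩC : (W.realPeriodRat : ℂ) ≠ 0 :=
    Complex.ofReal_ne_zero.mpr (W.realPeriodRat_pos_holds).ne'
  have hq' : W.entireLFunction 1 / (W.realPeriodRat : ℂ) = (((ϖ * ratPlusSymbol f 0 : ℚ)) : ℂ) := by
    rw [hf.entireLFunction_one_eq, ← hϖ, div_eq_iff hΩC]
    push_cast
    ring
  have hteq : ϖ * ratPlusSymbol f 0 = t := by
    have h := ht.symm.trans hq'
    exact_mod_cast h.symm
  have htp : ((ϖ : ℚ) : ℚ_[p]) * ((ratPlusSymbol f 0 : ℚ) : ℚ_[p]) = ((t : ℚ) : ℚ_[p]) := by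
    rw [← hteq]; push_cast; ring
  -- `‖log_p γ‖ = p⁻¹`
  have hlog : ‖padicLog p (cyclotomicGenerator p : ℚ_[p])‖ = (p : ℝ)⁻¹ := by
    obtain ⟨v, hv⟩ := exists_unit_padicLog_cyclotomicGenerator p hX.ne_two
    rw [hv, norm_mul, Padic.norm_p, PadicInt.padic_norm_e_of_padicInt,
      PadicInt.isUnit_iff.mp v.isUnit, mul_one]
  have hp0 : (p : ℝ)⁻¹ ≠ 0 := inv_ne_zero (Nat.cast_ne_zero.mpr (Fact.out : p.Prime).ne_zero)
  -- `ϖ · coeff₁(L) · log_p γ = 𝓛 · t`, then norms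
  have key : ((ϖ : ℚ) : ℚ_[p]) * PowerSeries.coeff 1 L * padicLog p (cyclotomicGenerator p : ℚ_[p]) =
      LInvariant Dq * ((t : ℚ) : ℚ_[p]) := by
    rw [mul_assoc, h1, ← htp]; ring
  have hn : ‖((ϖ : ℚ) : ℚ_[p]) * PowerSeries.coeff 1 L‖ * (p : ℝ)⁻¹ = (p : ℝ)⁻¹ := by
    rw [← hlog, ← norm_mul, key, hexc Dq, hlog]
  refine ⟨1, ?_⟩
  rw [PowerSeries.coeff_C_mul]
  exact mul_right_cancel₀ hp0 (hn.trans (one_mul _).symm)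

/-- **DEPRECATED — VACUOUS on its own domain, do not use** (kept under the tree's append-only rule «deprecate, don't
mutate»; see §1b's census paragraph and the `deprecated` message). Original docstring: **EXCEPTIONAL-ZERO DOOR (crux-U currency): at a SPLIT non-surjective X11a pair,
`L(E,1)/Ω_E = t` and `‖𝓛_p(E)·t‖_p = p⁻¹` give `Typed.MissingUpperBoundAt W p`** — §1b's μ-claim fed
to §1's door; modulo the ten facts + Greenberg–Stevens at the pair, the image bit displayed. This is
the p3 strategy sentence («Kato divisibility at split multiplicative `p` + Greenberg–Stevens
𝓛-invariant ⇒ r0 upper bound on `#Ш[p^∞]`») per pair with TWO displayed numbers and no modular symbol;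
it is silent when `‖𝓛_p(E)·t‖ ≠ p⁻¹` (then a higher coefficient is needed: the μ-witness of §2).
[cite: GreenbergStevens1993, Introduction Thm. (0.3) (p. 407)] [cite: Kato2004Asterisque, §17.13 (pp. 279–280)]
[cite: Wuthrich2014, Cor. 18 (p. 398)] [cite: SteinWuthrich2013, Thm. 6.1 (p. 20)] [cite: Miller2011LMS, Def. 1.1] -/
@[deprecated "VACUOUS on its own domain (REF g4 ruling R4-1, lit g5 F26-2, 2026-08-27): ¬Surj ∧ Irr ⇒ the Tate extension splits locally ⇒ ord_p 𝓛_p(E) ≥ 2 − ord_p v, so `hexc` is never satisfied by a BSD-consistent non-surjective pair; use ClassX11a.missingUpperBoundAt_of_muAnZeroAt_of_not_surj with a μ-witness of index ≥ 2 (part 7 record doors)" (since := "2026-08-27")]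
theorem _root_.Summit.BirchSwinnertonDyer.Rank1Residual.ClassX11a.missingUpperBoundAt_of_split_of_norm_LInvariant
    (hJs : thm61_splitMultiplicative) (hJn : thm61_nonsplitMultiplicative)
    (hGZK : rank_eq_analyticRank_of_analyticRank_le_one) (hpar : nonempty_modularParametrizationData)
    (h12 : Kato2004.thm12_4)
    (hns : Kato2004.exists_multDivisibilityInputs_nonsplit)
    (hsp : Kato2004.exists_multDivisibilityInputs_split)
    (h15 : thm15_isTorsion_multiplicative_rat)
    (h18 : Wuthrich2014.corollary18_padicLFunction_mem_iwasawaAlgebra_multiplicative)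
    (hfine : Kato2004.exists_multDivisibilityInputs_fine)
    (hGS : greenberg_stevens (W := W) (p := p))
    (hX : ClassX11a W p) (hnsj : ¬ Surj W p) (hsplit : W.HasSplitMultiplicativeReductionAtPrime p)
    (t : ℚ) (ht : W.entireLFunction 1 / (W.realPeriodRat : ℂ) = (t : ℂ))
    (hexc : ∀ Dq : TateParameterData W p, ‖LInvariant Dq * ((t : ℚ) : ℚ_[p])‖ = (p : ℝ)⁻¹) :
    MissingUpperBoundAt W p :=
  hX.missingUpperBoundAt_of_muAnZeroAt_of_not_surj hJs hJn hGZK hpar h12 hns hsp h15 h18 hfine hGS hnsj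
    (hX.muAnZeroAt_of_split_of_norm_LInvariant hGS hsplit t ht hexc)

/-- **DEPRECATED — VACUOUS (hypotheses jointly unsatisfiable), do not use** (append-only tombstone; REF R4-1 (a)).
Original docstring: **EXCEPTIONAL-ZERO DOOR (`BSD(E,p)`) at a SPLIT non-surjective UNIT pair** (`#Ш_an = q`,
`ord_p q = 0`, so the lower half is free): `L(E,1)/Ω_E = t` and `‖𝓛_p(E)·t‖_p = p⁻¹` give
`BSDp W p` modulo the ten facts + GS + the image bit. PER PAIR (E1 currency); not a class theorem.
[cite: GreenbergStevens1993, Introduction Thm. (0.3) (p. 407)] [cite: Kato2004Asterisque, §17.13 (pp. 279–280)]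
[cite: Wuthrich2014, Cor. 18 (p. 398)] [cite: Miller2011LMS, §1 and Def. 1.1] -/
@[deprecated "VACUOUS on its own domain (REF g4 ruling R4-1, lit g5 F26-2, 2026-08-27): ¬Surj ∧ Irr ⇒ the Tate extension splits locally ⇒ ord_p 𝓛_p(E) ≥ 2 − ord_p v, so `hexc` is never satisfied by a BSD-consistent non-surjective pair; use ClassX11a.missingUpperBoundAt_of_muAnZeroAt_of_not_surj with a μ-witness of index ≥ 2 (part 7 record doors)" (since := "2026-08-27")]
theorem _root_.Summit.BirchSwinnertonDyer.Rank1Residual.ClassX11a.bsdp_of_split_of_norm_LInvariant_of_unit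
    (hJs : thm61_splitMultiplicative) (hJn : thm61_nonsplitMultiplicative)
    (hGZK : rank_eq_analyticRank_of_analyticRank_le_one) (hpar : nonempty_modularParametrizationData)
    (h12 : Kato2004.thm12_4)
    (hns : Kato2004.exists_multDivisibilityInputs_nonsplit)
    (hsp : Kato2004.exists_multDivisibilityInputs_split)
    (h15 : thm15_isTorsion_multiplicative_rat)
    (h18 : Wuthrich2014.corollary18_padicLFunction_mem_iwasawaAlgebra_multiplicative)
    (hfine : Kato2004.exists_multDivisibilityInputs_fine)
    (hGS : greenberg_stevens (W := W) (p := p))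
    (hX : ClassX11a W p) (hnsj : ¬ Surj W p) (hsplit : W.HasSplitMultiplicativeReductionAtPrime p)
    (t : ℚ) (ht : W.entireLFunction 1 / (W.realPeriodRat : ℂ) = (t : ℂ))
    (hexc : ∀ Dq : TateParameterData W p, ‖LInvariant Dq * ((t : ℚ) : ℚ_[p])‖ = (p : ℝ)⁻¹)
    {q : ℚ} (hq : shaAn W = (q : ℂ)) (hv : padicValRat p q = 0) : BSDp W p :=
  hX.bsdp_of_muAnZeroAt_of_not_surj_of_unit hJs hJn hGZK hpar h12 hns hsp h15 h18 hfine hGS hnsj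
    (hX.muAnZeroAt_of_split_of_norm_LInvariant hGS hsplit t ht hexc) hq hv

end Summit.BirchSwinnertonDyer.Rank1Residual.X11a

end
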